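import Mathlib.Tactic.Linarith
import Mathlib.Data.Fintype.EquivFin
import Literature.Computability.MetaComplexity.PartialBijections
import Summits.ValiantsHypothesis.ValiantsHypothesis.Theorems.KPlusLogSqLawTropicalBSplitGlue
import Summits.ValiantsHypothesis.ValiantsHypothesis.Theorems.KPlusLogSqLawTropicalBChangedSetExclusivity
import Summits.ValiantsHypothesis.ValiantsHypothesis.Theorems.KPlusLogSqLawTropicalBSeparatedLex

/-!
# Route «KPlusLogSqLaw», crux `TropicalB` (stmt-ValiantsHypothesis-19771) — SEPARATED DESIGNS: THE LEVEL BRIDGE IS ROBUST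
# (valuations within `R` of the lexicographic lattice)

HONEST FRAMING.  Helper toward the registered stubs `stub_tropThin` / `stub_tropFat` of `Cruxes/TropicalB/Lines/birth.lean`
(crux `Summit.ValiantsHypothesis.ValiantsHypothesis.Theses.KPlusLogSqLaw.TropicalB`, item stmt-ValiantsHypothesis-19771, route
KPlusLogSqLaw; cell `pub-symmetroid`, seat val-sym-trop-p1 g8, 2026-08-27; `--supports … --as helper`).  A SECTOR lemma; nothing here
bounds `TropicalB` for general designs or bears on `WeakLifting`, DoorA26 / DoorA34, `MatrixDescartes` or VP ≠ VNP.

THE POINT (seat memo SEPARATED-LEVELS-g8.md §5 (3), «the sector has interior»).  `SeparatedLex.level_min_of_isDominant`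
(…TropicalBSeparatedLex) assumed the valuations of every class `j ≠ z` lie EXACTLY on the lattice, `v a b j = d j · u a b j`.
Here the same conclusion — the class-`l` cells of a term dominant at a window slope minimise the LATTICE level objective
`Φ_θ(M) = Σ_{(a,b)∈M} u a b l − θ·|M|` over the matchings of present class-`l` cells avoiding the higher classes' rows and
columns — is proved for valuations within `R` of the lattice, `|v a b j − d j · u a b j| ≤ R`, at the price of the separation
constant `8m²(A+R+1)` in place of `8m²(A+1)` (`level_min_of_isDominant_robust`).  Reason: a strict improvement of the integer
objective `Φ_θ` is worth `≥ d l` in weight, while the off-lattice parts of all columns together move the weight by `≤ 3m·R`, and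
`3m·R < d l` under the separation hypothesis.  Consequently the whole lexicographic tower (…SeparatedLevelStep / …SeparatedTower /
…SeparatedTowerAll) runs on an open neighbourhood (in the scale-relative sup norm) of the pure lexicographic designs, not only on
the lattice itself: the linear chain bound of the separated sector is not a knife-edge phenomenon.
-/

set_option linter.dupNamespace false
set_option autoImplicit false

namespace Summit.ValiantsHypothesis.ValiantsHypothesis.Theorems.KPlusLogSqLaw

namespace SeparatedLex

open Summit.ValiantsHypothesis.ValiantsHypothesis.Theorems.MatrixDescartes.Negative
open Finset
open scoped BigOperators
open Literature.Computability.MetaComplexity.PBij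

variable {m K : ℕ}

/-- **ROBUST LEVEL MINIMALITY OF A DOMINANT TERM** (memo §5 (3)).  As `SeparatedLex.level_min_of_isDominant`, but the valuations of
the classes `j ≠ z` need only lie within `B` of the lattice: `|v a b j − d j · u a b j| ≤ B` with digits `|u| ≤ A`, bottom class
`z` dense with `d z = 0` and `|v a b z| ≤ A`, exponents injective and super-separated with the constant `8m²(A+B+1)`.  If `p` is
dominant at an integer slope `θ` with `|θ| ≤ (2m+1)A + 1`, then for every class `l ≠ z` and every matching `X` of present
class-`l` cells avoiding the rows and columns that `p` uses in classes of larger exponent,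
`Φ_θ(class-l cells of p) ≤ Φ_θ(X)` for the LATTICE objective `Φ_θ(M) = Σ_{(a,b)∈M} u a b l − θ·|M|`. -/
theorem level_min_of_isDominant_robust (d : Fin K → ℕ) (v ε : Fin m → Fin m → Fin K → ℤ) (u : Fin m → Fin m → Fin K → ℤ)
    (A B : ℕ) (z l : Fin K) (hlz : l ≠ z) (hdz : d z = 0) (hinj : Function.Injective d)
    (huR : ∀ a b j, j ≠ z → |v a b j - (d j : ℤ) * u a b j| ≤ B) (huA : ∀ a b j, |u a b j| ≤ A) (hvz : ∀ a b, |v a b z| ≤ A)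
    (hdense : ∀ a b, ε a b z ≠ 0)
    (hsep : ∀ j j', d j < d j' → 8 * m ^ 2 * (A + B + 1) * d j ≤ d j') (hsep0 : ∀ j, j ≠ z → 8 * m ^ 2 * (A + B + 1) ≤ d j)
    {θ : ℤ} (hθ : |θ| ≤ (2 * m + 1) * A + 1) {p : Equiv.Perm (Fin m) × (Fin m → Fin K)} (hp : IsDominant d v ε θ p)
    (X : Finset (Fin m × Fin m)) (hX : IsPMatching X)
    (hXE : ∀ e ∈ X, ε e.1 e.2 l ≠ 0) (hXr : ∀ e ∈ X, ∀ b, d l < d (p.2 b) → p.1 b ≠ e.1)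
    (hXc : ∀ e ∈ X, ¬ d l < d (p.2 e.2)) :
    ∑ e ∈ ((Finset.univ.filter fun b : Fin m => p.2 b = l).image fun b => (p.1 b, b)), u e.1 e.2 l
        - θ * ((((Finset.univ.filter fun b : Fin m => p.2 b = l).image fun b => (p.1 b, b))).card : ℤ)
      ≤ ∑ e ∈ X, u e.1 e.2 l - θ * (X.card : ℤ) := by
  classical
  -- shorthand
  set R : Finset (Fin m × Fin m) := (Finset.univ.filter fun b : Fin m => p.2 b = l).image fun b => (p.1 b, b) with hR
  by_contra hlt
  rw [not_le] at hlt
  -- the high columns and rows of `p`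
  set Jh : Finset (Fin m) := Finset.univ.filter fun b => d l < d (p.2 b) with hJh
  set Hr : Finset (Fin m) := Jh.image p.1 with hHr
  have hmemJh : ∀ b, b ∈ Jh ↔ d l < d (p.2 b) := fun b => by simp [hJh]
  have hmemHr : ∀ a, a ∈ Hr ↔ ∃ b, d l < d (p.2 b) ∧ p.1 b = a := fun a => by
    simp only [hHr, Finset.mem_image, hmemJh]
  -- rows / columns of `X`
  have hXcol : ∀ e ∈ X, e.2 ∉ Jh := fun e he h => hXc e he ((hmemJh _).1 h)
  have hXrow : ∀ e ∈ X, e.1 ∉ Hr := by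
    intro e he h
    obtain ⟨b, hb, hba⟩ := (hmemHr _).1 h
    exact hXr e he b hb hba
  -- the free columns and rows
  set C0 : Finset (Fin m) := (Finset.univ \ Jh) \ rng X with hC0
  set R0 : Finset (Fin m) := (Finset.univ \ Hr) \ dom X with hR0
  have hcardHr : Hr.card = Jh.card := Finset.card_image_of_injective _ p.1.injective
  have hrngJh : Disjoint (rng X) Jh := Finset.disjoint_left.2 fun b hb hbJ => by
    obtain ⟨a, hab⟩ := mem_rng.1 hb; exact hXcol _ hab hbJ
  have hdomHr : Disjoint (dom X) Hr := Finset.disjoint_left.2 fun a ha haH => by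
    obtain ⟨b, hab⟩ := mem_dom.1 ha; exact hXrow _ hab haH
  have hcardC0 : C0.card = m - Jh.card - X.card := by
    rw [hC0, Finset.card_sdiff_of_subset (by
      intro b hb; rw [Finset.mem_sdiff]; exact ⟨Finset.mem_univ _, fun h => Finset.disjoint_left.1 hrngJh hb h⟩),
      Finset.card_sdiff_of_subset (Finset.subset_univ _), Finset.card_univ, Fintype.card_fin, hX.card_rng]
  have hcardR0 : R0.card = m - Jh.card - X.card := by
    rw [hR0, Finset.card_sdiff_of_subset (by
      intro a ha; rw [Finset.mem_sdiff]; exact ⟨Finset.mem_univ _, fun h => Finset.disjoint_left.1 hdomHr ha h⟩),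
      Finset.card_sdiff_of_subset (Finset.subset_univ _), Finset.card_univ, Fintype.card_fin, hX.card_dom, hcardHr]
  have hcardCR : Fintype.card C0 = Fintype.card R0 := by rw [Fintype.card_coe, Fintype.card_coe, hcardC0, hcardR0]
  let φ : C0 ≃ R0 := Fintype.equivOfCardEq hcardCR
  -- the row partner inside `X`
  have hxrow : ∀ b, b ∈ rng X → ∃ a, (a, b) ∈ X := fun b hb => mem_rng.1 hb
  -- the competitor's permutation
  have hmemC0 : ∀ b, b ∉ Jh → b ∉ rng X → b ∈ C0 := fun b h1 h2 => by
    rw [hC0, Finset.mem_sdiff, Finset.mem_sdiff]; exact ⟨⟨Finset.mem_univ _, h1⟩, h2⟩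
  let g : Fin m → Fin m := fun b =>
    if hb : b ∈ Jh then p.1 b
    else if hx : b ∈ rng X then (hxrow b hx).choose
    else (φ ⟨b, hmemC0 b hb hx⟩ : R0)
  have hg_high : ∀ b, b ∈ Jh → g b = p.1 b := fun b hb => by simp only [g, hb, dif_pos]
  have hg_X : ∀ b (hx : b ∈ rng X), b ∉ Jh → (g b, b) ∈ X := fun b hx hb => by
    simp only [g, hb, dif_neg, not_false_eq_true, hx, dif_pos]; exact (hxrow b hx).choose_spec
  have hg_free : ∀ b, b ∉ Jh → b ∉ rng X → g b ∈ R0 := fun b hb hx => by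
    simp only [g, hb, hx, dif_neg, not_false_eq_true]; exact (φ ⟨b, hmemC0 b hb hx⟩).2
  have hmemR0 : ∀ a, a ∈ R0 ↔ a ∉ Hr ∧ a ∉ dom X := fun a => by
    rw [hR0, Finset.mem_sdiff, Finset.mem_sdiff]; simp
  have hginj : Function.Injective g := by
    intro b b' h
    by_cases hb : b ∈ Jh <;> by_cases hb' : b' ∈ Jh
    · rw [hg_high b hb, hg_high b' hb'] at h; exact p.1.injective h
    · exfalso
      rw [hg_high b hb] at h
      have hHr1 : p.1 b ∈ Hr := Finset.mem_image_of_mem _ hb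
      by_cases hx' : b' ∈ rng X
      · have := hg_X b' hx' hb'; rw [← h] at this; exact hXrow _ this hHr1
      · have := hg_free b' hb' hx'; rw [← h, hmemR0] at this; exact this.1 hHr1
    · exfalso
      rw [hg_high b' hb'] at h
      have hHr1 : p.1 b' ∈ Hr := Finset.mem_image_of_mem _ hb'
      by_cases hx : b ∈ rng X
      · have := hg_X b hx hb; rw [h] at this; exact hXrow _ this hHr1
      · have := hg_free b hb hx; rw [h, hmemR0] at this; exact this.1 hHr1
    · by_cases hx : b ∈ rng X <;> by_cases hx' : b' ∈ rng X
      · have h1 := hg_X b hx hb; have h2 := hg_X b' hx' hb'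
        rw [h] at h1; exact hX.eq_of_fst_eq h1 h2 ▸ rfl
      · exfalso
        have h1 := hg_X b hx hb; have h2 := hg_free b' hb' hx'
        rw [← h, hmemR0] at h2; exact h2.2 (mem_dom.2 ⟨b, h1⟩)
      · exfalso
        have h1 := hg_free b hb hx; have h2 := hg_X b' hx' hb'
        rw [h, hmemR0] at h1; exact h1.2 (mem_dom.2 ⟨b', h2⟩)
      · have e1 : g b = (φ ⟨b, hmemC0 b hb hx⟩ : R0) := by simp only [g, hb, hx, dif_neg, not_false_eq_true]
        have e2 : g b' = (φ ⟨b', hmemC0 b' hb' hx'⟩ : R0) := by simp only [g, hb', hx', dif_neg, not_false_eq_true]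
        have : φ ⟨b, hmemC0 b hb hx⟩ = φ ⟨b', hmemC0 b' hb' hx'⟩ := Subtype.ext (by rw [← e1, ← e2, h])
        exact congrArg Subtype.val (φ.injective this)
  have hgbij : Function.Bijective g := Finite.injective_iff_bijective.mp hginj
  -- the competitor
  let lam : Fin m → Fin K := fun b => if b ∈ Jh then p.2 b else if b ∈ rng X then l else z
  let q : Equiv.Perm (Fin m) × (Fin m → Fin K) := (Equiv.ofBijective g hgbij, lam)
  have hq1 : ∀ b, q.1 b = g b := fun b => rfl
  have hq2 : ∀ b, q.2 b = lam b := fun b => rfl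
  -- present
  have hp_pres := (termSign_ne_zero_iff ε p).1 hp.1
  have hq_pres : termSign ε q ≠ 0 := by
    rw [termSign_ne_zero_iff]
    intro b
    rw [hq1, hq2]
    by_cases hb : b ∈ Jh
    · simp only [lam, hb, if_true, hg_high b hb]; exact hp_pres b
    · by_cases hx : b ∈ rng X
      · simp only [lam, hb, hx, if_false, if_true]; exact hXE _ (hg_X b hx hb)
      · simp only [lam, hb, hx, if_false]; exact hdense _ _
  -- different from `p`: their class-`l` columns differ, or the row of one of them does
  have hq_ne : q ≠ p := by
    intro hqp
    -- then `X = R`, contradicting the strict inequality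
    have hXR : X = R := by
      ext e
      rw [hR, mem_cells]
      constructor
      · intro he
        have hb : e.2 ∉ Jh := hXcol e he
        have hx : e.2 ∈ rng X := mem_rng.2 ⟨e.1, he⟩
        have h1 := hg_X e.2 hx hb
        have hrow : g e.2 = e.1 := hX.eq_of_snd_eq h1 he
        have h2 : q.2 e.2 = l := by rw [hq2]; simp only [lam, hb, hx, if_false, if_true]
        rw [hqp] at h2
        have h3 : q.1 e.2 = e.1 := by rw [hq1, hrow]
        rw [hqp] at h3
        exact ⟨h3.symm, h2⟩
      · rintro ⟨h1, h2⟩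
        have hb : e.2 ∉ Jh := fun h => by rw [hmemJh, h2] at h; exact lt_irrefl _ h
        have hx : e.2 ∈ rng X := by
          by_contra hx
          have : q.2 e.2 = z := by rw [hq2]; simp only [lam, hb, hx, if_false]
          rw [hqp, h2] at this
          exact hlz this
        have h3 := hg_X e.2 hx hb
        have : g e.2 = p.1 e.2 := by rw [← hq1, hqp]
        rw [this, ← h1] at h3
        exact h3
    rw [hXR] at hlt
    exact lt_irrefl _ hlt
  -- dominance gives `W q < W p`; we show `W q > W p`
  have hdom := hp.2 q hq_ne hq_pres
  rw [RefreshExclusivity.tropWeight_eq_sum, RefreshExclusivity.tropWeight_eq_sum] at hdom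
  -- split both sums into high columns and the rest
  have hsplit : ∀ f : Fin m → ℤ, ∑ b, f b = ∑ b ∈ Jh, f b + ∑ b ∈ Finset.univ \ Jh, f b := fun f => by
    rw [← Finset.sum_union (Finset.disjoint_sdiff), Finset.union_sdiff_of_subset (Finset.subset_univ _)]
  rw [hsplit, hsplit (fun b => θ * (d (p.2 b) : ℤ) - v (p.1 b) b (p.2 b))] at hdom
  have hhigh : ∑ b ∈ Jh, (θ * (d (q.2 b) : ℤ) - v (q.1 b) b (q.2 b)) = ∑ b ∈ Jh, (θ * (d (p.2 b) : ℤ) - v (p.1 b) b (p.2 b)) := by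
    refine Finset.sum_congr rfl fun b hb => ?_
    rw [hq1, hq2, hg_high b hb]; simp only [lam, hb, if_true]
  rw [hhigh] at hdom
  -- so the low parts compare: Σ_low f_q < Σ_low f_p
  have hlow : ∑ b ∈ Finset.univ \ Jh, (θ * (d (q.2 b) : ℤ) - v (q.1 b) b (q.2 b)) <
      ∑ b ∈ Finset.univ \ Jh, (θ * (d (p.2 b) : ℤ) - v (p.1 b) b (p.2 b)) := by linarith
  -- LOWER BOUND for q's low part: split `univ \ Jh = rng X ∪ C0`
  have hlowsplit : Finset.univ \ Jh = rng X ∪ C0 := by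
    ext b; rw [Finset.mem_sdiff, Finset.mem_union, hC0, Finset.mem_sdiff, Finset.mem_sdiff]
    constructor
    · intro h; by_cases hx : b ∈ rng X
      · exact Or.inl hx
      · exact Or.inr ⟨⟨h.1, h.2⟩, hx⟩
    · rintro (h | h)
      · exact ⟨Finset.mem_univ _, fun hb => Finset.disjoint_left.1 hrngJh h hb⟩
      · exact ⟨h.1.1, h.1.2⟩
  have hdisjXC : Disjoint (rng X) C0 := by
    rw [hC0]; exact Finset.disjoint_sdiff
  have hB : (0 : ℤ) ≤ B := by positivity
  have hqX : ∀ b ∈ rng X, (d l : ℤ) * (θ - u (g b) b l) - B ≤ θ * (d (q.2 b) : ℤ) - v (q.1 b) b (q.2 b) := by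
    intro b hx
    have hb : b ∉ Jh := fun h => Finset.disjoint_left.1 hrngJh hx h
    rw [hq1, hq2]; simp only [lam, hb, hx, if_false, if_true]
    have h := huR (g b) b l hlz
    rw [abs_le] at h
    linarith only [h]
  have hqC : ∀ b ∈ C0, -(A : ℤ) ≤ θ * (d (q.2 b) : ℤ) - v (q.1 b) b (q.2 b) := by
    intro b hb
    have hb1 : b ∉ Jh := by rw [hC0, Finset.mem_sdiff, Finset.mem_sdiff] at hb; exact hb.1.2
    have hb2 : b ∉ rng X := by rw [hC0, Finset.mem_sdiff] at hb; exact hb.2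
    rw [hq1, hq2]; simp only [lam, hb1, hb2, if_false]
    rw [hdz]; push_cast
    have := hvz (g b) b
    rw [abs_le] at this
    linarith
  -- Σ over rng X of u (g b) b l equals Σ over X
  have hsumX : ∑ b ∈ rng X, ((d l : ℤ) * (θ - u (g b) b l) - B) =
      (d l : ℤ) * (θ * (X.card : ℤ) - ∑ e ∈ X, u e.1 e.2 l) - (X.card : ℤ) * B := by
    have hreidx : ∑ e ∈ X, u e.1 e.2 l = ∑ b ∈ rng X, u (g b) b l := by
      rw [show rng X = X.image Prod.snd from rfl, Finset.sum_image]
      · refine Finset.sum_congr rfl fun e he => ?_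
        have hb : e.2 ∉ Jh := hXcol e he
        have h1 := hg_X e.2 (mem_rng.2 ⟨e.1, he⟩) hb
        rw [hX.eq_of_snd_eq he h1]
      · intro e he e' he' h
        exact hX e he e' he' (Or.inr h)
    rw [hreidx, Finset.sum_sub_distrib, ← Finset.mul_sum, Finset.sum_sub_distrib, Finset.sum_const, Finset.sum_const, nsmul_eq_mul,
      nsmul_eq_mul, hX.card_rng]
    ring
  have hq_low : (d l : ℤ) * (θ * (X.card : ℤ) - ∑ e ∈ X, u e.1 e.2 l) - (m : ℤ) * A - (m : ℤ) * B ≤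
      ∑ b ∈ Finset.univ \ Jh, (θ * (d (q.2 b) : ℤ) - v (q.1 b) b (q.2 b)) := by
    rw [hlowsplit, Finset.sum_union hdisjXC]
    have h0 := Finset.sum_le_sum hqX
    rw [hsumX] at h0
    have h1 : ∑ b ∈ C0, (-(A : ℤ)) ≤ ∑ b ∈ C0, (θ * (d (q.2 b) : ℤ) - v (q.1 b) b (q.2 b)) := Finset.sum_le_sum hqC
    rw [Finset.sum_const, smul_neg, nsmul_eq_mul] at h1
    have h2 : (C0.card : ℤ) * A ≤ (m : ℤ) * A := by
      have : C0.card ≤ m := (Finset.card_le_univ _).trans (by simp)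
      exact mul_le_mul_of_nonneg_right (by exact_mod_cast this) (by positivity)
    have h3 : (X.card : ℤ) * B ≤ (m : ℤ) * B := by
      have : X.card ≤ m := by
        have := hX.card_rng
        calc X.card = (rng X).card := this.symm
          _ ≤ m := (Finset.card_le_univ _).trans (by simp)
      exact mul_le_mul_of_nonneg_right (by exact_mod_cast this) hB
    linarith
  -- UPPER BOUND for p's low part: split by class `l` / other low classes
  set Jl : Finset (Fin m) := Finset.univ.filter fun b : Fin m => p.2 b = l with hJl
  have hJl_sub : Jl ⊆ Finset.univ \ Jh := by
    intro b hb
    rw [Finset.mem_sdiff]; refine ⟨Finset.mem_univ _, fun h => ?_⟩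
    rw [hmemJh] at h; rw [hJl, Finset.mem_filter] at hb; rw [hb.2] at h; exact lt_irrefl _ h
  have hpsplit : ∑ b ∈ Finset.univ \ Jh, (θ * (d (p.2 b) : ℤ) - v (p.1 b) b (p.2 b)) =
      ∑ b ∈ Jl, (θ * (d (p.2 b) : ℤ) - v (p.1 b) b (p.2 b)) +
      ∑ b ∈ (Finset.univ \ Jh) \ Jl, (θ * (d (p.2 b) : ℤ) - v (p.1 b) b (p.2 b)) := by
    rw [← Finset.sum_union Finset.disjoint_sdiff, Finset.union_sdiff_of_subset hJl_sub]
  have hpl : ∑ b ∈ Jl, (θ * (d (p.2 b) : ℤ) - v (p.1 b) b (p.2 b)) ≤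
      (d l : ℤ) * (θ * (R.card : ℤ) - ∑ e ∈ R, u e.1 e.2 l) + (m : ℤ) * B := by
    rw [hR, card_cells, sum_cells, ← hJl]
    dsimp only
    have hle : ∀ b ∈ Jl, θ * (d (p.2 b) : ℤ) - v (p.1 b) b (p.2 b) ≤ (d l : ℤ) * (θ - u (p.1 b) b l) + B := by
      intro b hb
      rw [hJl, Finset.mem_filter] at hb
      rw [hb.2]
      have h := huR (p.1 b) b l hlz
      rw [abs_le] at h
      linarith only [h]
    have h0 := Finset.sum_le_sum hle
    have e1 : ∑ b ∈ Jl, ((d l : ℤ) * (θ - u (p.1 b) b l) + (B : ℤ)) =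
        (d l : ℤ) * (θ * (Jl.card : ℤ) - ∑ b ∈ Jl, u (p.1 b) b l) + (Jl.card : ℤ) * B := by
      rw [Finset.sum_add_distrib, Finset.sum_const, nsmul_eq_mul, ← Finset.mul_sum, Finset.sum_sub_distrib, Finset.sum_const,
        nsmul_eq_mul]
      ring
    have h3 : (Jl.card : ℤ) * B ≤ (m : ℤ) * B := by
      have : Jl.card ≤ m := (Finset.card_le_univ _).trans (by simp)
      exact mul_le_mul_of_nonneg_right (by exact_mod_cast this) hB
    linarith only [h0, e1, h3]
  -- per-column bound on the other low columns: `N·(θ d_j − v) ≤ ((2m+2)A+1)·d l + N·(A+B)`, `N = 8m²(A+B+1)`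
  set Nz : ℤ := 8 * (m : ℤ) ^ 2 * (A + B + 1) with hNz
  have hN0 : (0 : ℤ) ≤ Nz := by positivity
  have hA : (0 : ℤ) ≤ A := by positivity
  have hdl : (0 : ℤ) ≤ d l := by positivity
  have hθ' := hθ
  rw [abs_le] at hθ'
  have hpo : ∀ b ∈ (Finset.univ \ Jh) \ Jl,
      Nz * (θ * (d (p.2 b) : ℤ) - v (p.1 b) b (p.2 b)) ≤ ((2 * (m : ℤ) + 2) * A + 1) * (d l : ℤ) + Nz * (A + B) := by
    intro b hb
    rw [Finset.mem_sdiff, Finset.mem_sdiff, hmemJh, hJl, Finset.mem_filter] at hb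
    have hne : p.2 b ≠ l := fun h => hb.2 ⟨Finset.mem_univ _, h⟩
    have hnot : ¬ d l < d (p.2 b) := hb.1.2
    have hpos : (0 : ℤ) ≤ ((2 * (m : ℤ) + 2) * A + 1) * (d l : ℤ) := by positivity
    have hNB : (0 : ℤ) ≤ Nz * B := mul_nonneg hN0 hB
    by_cases hz : p.2 b = z
    · rw [hz, hdz]; push_cast
      have hv := hvz (p.1 b) b; rw [abs_le] at hv
      have h1 : θ * 0 - v (p.1 b) b z ≤ A := by linarith
      have h2 : Nz * (θ * 0 - v (p.1 b) b z) ≤ Nz * A := mul_le_mul_of_nonneg_left h1 hN0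
      have e : Nz * ((A : ℤ) + B) = Nz * A + Nz * B := by ring
      linarith
    · -- a genuinely lower class `j`: `N · d j ≤ d l`
      have hlt' : d (p.2 b) < d l := lt_of_le_of_ne (not_lt.1 hnot) (fun h => hne (hinj h))
      have hs' : Nz * (d (p.2 b) : ℤ) ≤ d l := by rw [hNz]; exact_mod_cast hsep _ _ hlt'
      have hvu := huR (p.1 b) b (p.2 b) hz; rw [abs_le] at hvu
      have hua := huA (p.1 b) b (p.2 b); rw [abs_le] at hua
      have hdj : (0 : ℤ) ≤ d (p.2 b) := by positivity
      have h1 : θ - u (p.1 b) b (p.2 b) ≤ (2 * m + 2) * A + 1 := by linarith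
      have h2 : (d (p.2 b) : ℤ) * (θ - u (p.1 b) b (p.2 b)) ≤ (d (p.2 b) : ℤ) * ((2 * m + 2) * A + 1) :=
        mul_le_mul_of_nonneg_left h1 hdj
      have h3 : Nz * ((d (p.2 b) : ℤ) * (θ - u (p.1 b) b (p.2 b))) ≤ Nz * ((d (p.2 b) : ℤ) * ((2 * m + 2) * A + 1)) :=
        mul_le_mul_of_nonneg_left h2 hN0
      have h4 : Nz * (d (p.2 b) : ℤ) * ((2 * m + 2) * A + 1) ≤ (d l : ℤ) * ((2 * m + 2) * A + 1) :=
        mul_le_mul_of_nonneg_right hs' (by positivity)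
      have h5 : (0 : ℤ) ≤ Nz * A := mul_nonneg hN0 hA
      have h6 : θ * (d (p.2 b) : ℤ) - v (p.1 b) b (p.2 b) ≤ (d (p.2 b) : ℤ) * (θ - u (p.1 b) b (p.2 b)) + B := by
        linarith only [hvu]
      have h7 : Nz * (θ * (d (p.2 b) : ℤ) - v (p.1 b) b (p.2 b)) ≤ Nz * ((d (p.2 b) : ℤ) * (θ - u (p.1 b) b (p.2 b)) + B) :=
        mul_le_mul_of_nonneg_left h6 hN0
      have e2 : Nz * ((d (p.2 b) : ℤ) * ((2 * m + 2) * A + 1)) = Nz * (d (p.2 b) : ℤ) * ((2 * m + 2) * A + 1) := by ring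
      have e3 : (d l : ℤ) * ((2 * m + 2) * A + 1) = ((2 * (m : ℤ) + 2) * A + 1) * (d l : ℤ) := by ring
      have e4 : Nz * ((d (p.2 b) : ℤ) * (θ - u (p.1 b) b (p.2 b)) + B) =
          Nz * ((d (p.2 b) : ℤ) * (θ - u (p.1 b) b (p.2 b))) + Nz * B := by ring
      have e5 : Nz * ((A : ℤ) + B) = Nz * A + Nz * B := by ring
      linarith only [h3, h4, h5, h7, e2, e3, e4, e5, hpos, hNB]
  have hp_low : Nz * ∑ b ∈ Finset.univ \ Jh, (θ * (d (p.2 b) : ℤ) - v (p.1 b) b (p.2 b)) ≤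
      Nz * ((d l : ℤ) * (θ * (R.card : ℤ) - ∑ e ∈ R, u e.1 e.2 l) + (m : ℤ) * B) +
        (m : ℤ) * (((2 * (m : ℤ) + 2) * A + 1) * (d l : ℤ) + Nz * (A + B)) := by
    rw [hpsplit, mul_add]
    have hl' := mul_le_mul_of_nonneg_left hpl hN0
    have h1 := Finset.sum_le_sum hpo
    rw [← Finset.mul_sum, Finset.sum_const, nsmul_eq_mul] at h1
    have hcard : (((Finset.univ \ Jh) \ Jl).card : ℤ) ≤ m := by
      have : ((Finset.univ \ Jh) \ Jl).card ≤ m := (Finset.card_le_univ _).trans (by simp)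
      exact_mod_cast this
    have hnn : (0 : ℤ) ≤ ((2 * (m : ℤ) + 2) * A + 1) * (d l : ℤ) + Nz * (A + B) := by positivity
    have h2 := mul_le_mul_of_nonneg_right hcard hnn
    linarith
  -- combine
  have hN : Nz ≤ d l := by rw [hNz]; exact_mod_cast hsep0 l hlz
  have hm1 : (1 : ℤ) ≤ m := by
    rcases Nat.eq_zero_or_pos m with h | h
    · exfalso
      subst h
      have hX0 : X = ∅ := Finset.eq_empty_of_forall_notMem fun e _ => e.1.elim0
      have hR0 : R = ∅ := Finset.eq_empty_of_forall_notMem fun e _ => e.1.elim0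
      rw [hX0, hR0] at hlt
      simp at hlt
    · exact_mod_cast h
  have hNpos : (0 : ℤ) < Nz := by rw [hNz]; positivity
  have hgap : θ * (R.card : ℤ) - ∑ e ∈ R, u e.1 e.2 l + 1 ≤ θ * (X.card : ℤ) - ∑ e ∈ X, u e.1 e.2 l := by
    linarith only [hlt]
  have h1 := mul_lt_mul_of_pos_left hlow hNpos
  have h3 := mul_le_mul_of_nonneg_left hq_low hN0
  have h5 : (d l : ℤ) * (θ * (R.card : ℤ) - ∑ e ∈ R, u e.1 e.2 l + 1) ≤ (d l : ℤ) * (θ * (X.card : ℤ) - ∑ e ∈ X, u e.1 e.2 l) :=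
    mul_le_mul_of_nonneg_left hgap hdl
  have h6 := mul_le_mul_of_nonneg_left h5 hN0
  have h7 : Nz * ((m : ℤ) * A) ≤ (d l : ℤ) * ((m : ℤ) * A) := mul_le_mul_of_nonneg_right hN (by positivity)
  have h7b : Nz * ((m : ℤ) * B) ≤ (d l : ℤ) * ((m : ℤ) * B) := mul_le_mul_of_nonneg_right hN (by positivity)
  have hdlpos : (0 : ℤ) < d l := lt_of_lt_of_le hNpos hN
  have e1 : (0 : ℤ) ≤ ((m : ℤ) - 1) * m * A := mul_nonneg (mul_nonneg (sub_nonneg.2 hm1) (by positivity)) hA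
  have e2 : (0 : ℤ) ≤ ((m : ℤ) - 1) * m := mul_nonneg (sub_nonneg.2 hm1) (by positivity)
  have e3 : (0 : ℤ) ≤ (m : ℤ) * A := by positivity
  have e4 : (0 : ℤ) ≤ ((m : ℤ) - 1) * m * B := mul_nonneg (mul_nonneg (sub_nonneg.2 hm1) (by positivity)) hB
  have e5 : (0 : ℤ) ≤ (m : ℤ) * B := by positivity
  have e6 : (0 : ℤ) ≤ (m : ℤ) ^ 2 * B := by positivity
  have hcoef : (0 : ℤ) < 8 * (m : ℤ) ^ 2 * A + 8 * (m : ℤ) ^ 2 * B + 8 * (m : ℤ) ^ 2 -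
      ((2 * (m : ℤ) ^ 2 + 4 * m) * A + 3 * (m : ℤ) * B + m) := by
    linarith only [e1, e2, e3, e4, e5, e6, hm1, hA, hB]
  have h9 := mul_pos hcoef hdlpos
  rw [hNz] at h1 h3 h6 h7 h7b hp_low
  linarith only [h1, h3, h6, h7, h7b, hp_low, h9]

end SeparatedLex

end Summit.ValiantsHypothesis.ValiantsHypothesis.Theorems.KPlusLogSqLaw
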